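import Summits.HodgeConjecture.HodgeConjecture.Theses.BiquadraticSecantLift
import Summits.HodgeConjecture.HodgeConjecture.Theorems.WeilTypeLadderVariationalLocal
import Summits.HodgeConjecture.HodgeConjecture.Theorems.HeckePrymWeilHyperbolicEightfoldsSqrtMinus7OfAnchorObject
import Literature.AlgebraicGeometry.HodgeTheory.WeilClassesCMReductionPolarized
import Literature.AlgebraicGeometry.HodgeTheory.WeilClassesFieldOneClass
import Literature.AlgebraicGeometry.HodgeTheory.WeilClassesFieldIsogenyInvariance
import Literature.AlgebraicGeometry.HodgeTheory.WeilClassesBlochSeed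
import Literature.AlgebraicGeometry.HodgeTheory.BlochSemiregularSpread
import Literature.AlgebraicGeometry.HodgeTheory.LefschetzOneOneHolds
import Literature.AlgebraicGeometry.HodgeTheory.IsoTransport
import Literature.AlgebraicGeometry.HodgeTheory.WeilClassesCyclicPrymDegreeTwelve
import HarnessLib
import HarnessLib.Audit

/-!
# Line `prymseed` for crux X1 `MarkmanBiquadraticTwelvefolds` (stmt-HodgeConjecture-22132) — the `seed` line WITH THE
# LEVER TYPED AT THE REFEREED ANCHOR: a seeded member ON the `ℤ/12`-Prym locus of the `(d, m) = (1, 3)` cell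

Third workfile on the crux (after `Lines/birth.lean`, registered 2026-08-27, and `Lines/seed.lean`, registered 2026-08-28 and
STILL the registered skeleton; `Lines/prym.lean` records the anchor). §0–§4 below are `Lines/seed.lean` VERBATIM (vocabulary,
local clause, SEED / REACH stubs, PROVED amplification, composition concluding the crux BY NAME); §5 is new. Nothing here
proves the Hodge conjecture, rung H2 `SevenfoldWeilCensus.WeilSixfolds`, X1, the rung `X1At 1 3` or the new designate
`PrymSeed13`: the load-bearing statements are `sorry` stubs. (X2 `BiquadraticBaseChangeHyperbolic` and X3
`BiquadraticWeilDescent` are CLOSED·proved since 2026-08-28T02:20Z / 02:50Z — `Theorems/BiquadraticSecantLiftBiquadraticBaseChangeHyperbolic.lean`,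
`Theorems/BiquadraticSecantLiftBiquadraticWeilDescent.lean`, prover lane — so X1 is the route's ONLY open crux and `closes`
now gives X1 ⟹ H2 outright; X2's proof picks `m = 2` or `m = d·a·b`, so every non-square `m` — and the cell `(1, 3)` —
stays on the route's path.)

## What §5 adds (tribunal T3: "does the witness exercise the lever?")

The tribunal's round-1 verdict named the missing T3 designate «`stub_rung_prymAnchor_secant` — generic `B`-secant pair /
flat `K′`-secant object AT a Schoen `ℤ/12`-Prym member of the `(1,3)` component; output under [Markman RM] Thm. 1.1.2 = the
whole 18-dim component». Since then the anchor LANDED in `Literature/…/WeilClassesCyclicPrymDegreeTwelve.lean` (p595926):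
the REFEREED fact `Schoen1988_cyclicPrym_weilClasses_algebraic_degreeTwelve_allGenera` (Schoen 1988 Thm. 2.0 + Cor. 3.1 at
`(q, m, r) = (n+1, 12, 0)` = Patel–Zhang Thm. 5.3: on the primitive Prym `4n`-fold of an étale `ℤ/12`-cover EVERY class of the
`ℚ(ζ₁₂)`-Weil space is algebraic) and the DERIVED placement `cyclicPrymTwelve_isHyperbolicWeilTypeCM_allGenera` (the genus-`4`
member `(B, η)`, a twelvefold, satisfies `IsHyperbolicWeilTypeCM B η R_(1,3) 2 3`: it is a member of the cell). The genus-`4`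
members form a `9`-dimensional algebraic ANCHOR LOCUS inside the `18`-dimensional hyperbolic `ℚ(ζ₁₂)`-family (Schoen pp. 25–26:
`(φ(12)/2)(h/2)² = 18` versus `3q - 3 = 9`; "the general abelian variety in this family will not be dominated by the Jacobian of
one of our curves"). §5 types THE LEVER AT THAT LOCUS and proves its wiring:

* `SeedBodyAt d m P η_P` — the body of `SeedAnchorAt d m` at a GIVEN member (`SeedAnchorAt d m ↔ ∃ P η_P, SeedBodyAt d m P η_P`,
  `Iff.rfl`); `BlochBodyAt` likewise for the lci entrance; `IsPrymTwelvefold C 𝒥 α s Φ s_B η` — the binder block of the two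
  Literature facts at `n = 3` (`g(C) = 37`, `α¹² = 𝟙` acting freely, `s = α_*`, `Φ = Φ₁₂(s)`, `B = (ker Φ)⁰`, `η = -𝟙 + 2s_B² + s_B³`).
* **`PrymSeed13 := ∃` a genus-`4` `ℤ/12`-Prym datum with `SeedBodyAt 1 3 ((ker Φ)⁰) η`** — a polarization class `h` (Kähler
  multiple, Rosati = complex conjugation on `L = ℚ(ζ₁₂)`, split discriminant, `η^*`-stable rational Lagrangian), a NON-ZERO
  RATIONAL `L`-Weil class `w`, and the LOCAL CLAUSE `LocalClauseAt B h w` (the route's TRANSPORT input: `q·H³ + W` algebraic on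
  a Euclidean neighbourhood of the Prym point in EVERY smooth projective family carrying `h`, `w` as global fibrewise-Hodge
  classes). NEW STUB `stub_prymSeed13 : PrymSeed13` (T3 designate, PLAN-ONLY): the `(1,3)`-instance of the line's hardest stub
  `stub_seedAnchor`, LOCALISED to the anchor locus.
* PROVED: `seedAnchorAt13_of_prymSeed : PrymSeed13 → SeedAnchorAt 1 3`; `rung_d1_m3_of_prymSeed : PrymSeed13 → SeedReachAt 1 3 →
  X1At 1 3` (the rung's plan on this line: LEVER AT THE ANCHOR + REACH (in print) ⟹ the whole `(1,3)` cell, by §4's amplification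
  — "output = the whole 18-dimensional component"); `prymSeed13_of_blochSpread : BlochSemiregularSpread 12 3 → PrymBlochSeed13 →
  PrymSeed13` (lci entrance, REFEREED Bloch fact); `prym_mem_cell` (the placement fact puts the member in the cell and supplies
  `IsWeilTypeCM B η R_(1,3) 2 3`, the first conjunct of the seed body); **`prym_basepoint`** (consumes Schoen's fact): for EVERY
  polarization class `h`, EVERY `w ∈ W_L(B) ⊗ ℂ` and EVERY `q ∈ ℚ`, `q·h³ + w ∈ algebraicClasses B.X 3` — the base-point requirement
  `s₀ ∈ U` of the local clause, which at any other member of the cell is itself an open problem, HOLDS AT THE ANCHOR FOR ALL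
  CANDIDATE DATA; `prymSeed13_of_localData` (consumes the placement fact): `PrymSeed13` follows from purely LOCAL data at one Prym
  member — `(h, w)` with the five polarization properties, `w ≠ 0` rational Weil, and `LocalClauseAt B h w`.

So the T3 package on this line reads: WITNESS PRESENT (`Lines/prym.lean` / the Literature rung theorem
`weilClassesField_cyclicPrymTwelvefold_algebraic_of_schoen1988`: X1's body on the Prym locus, sorry-free on a refereed fact — a
decided sub-case OUTSIDE S's known regime: twelvefolds, quartic CM field, not Markman's `K`-quadratic sixfolds) + LEVER-RUNG
PLAN-ONLY (`stub_prymSeed13`: the seed stub AT the witness locus; closing it and REACH closes the cell `X1At 1 3` by the proved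
`rung_d1_m3_of_prymSeed`). The honest caveat moves from «lever not exercised» to «lever typed at the anchor, not proved».

## Why the anchor is the right place to seed (what a prover starts from), and why it might fail

ENTRANCES to `LocalClauseAt` at a Prym member `B ⊂ J(C)` (`C` of genus `37` with a free `ℤ/12`-action, `C' = C/(ℤ/12)` of genus 4):
(i) lci/BLOCH (`prymSeed13_of_blochSpread`): an integral lci `Z ⊂ B` of codimension `3`, Bloch-semiregular, with `[Z] ∝ q·h³ + w`.
The anchor is CURVE-DOMINATED, so — unlike the generic RM member (no objects known) and unlike the CM/induced members
(`E_ω³ ⊗ O_F`, where DOOR #3 of `pub-hsemireg/step0/C/TWISTED-KUNNETH.md` §5.4/§5.6 shows every box/induced object obstructed) —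
it carries explicit cycles: Schoen's generators `z_χ = Σ_t χ(-t) σ(t)_* Q`, `Q ≅ ℙ³` a component of the preimage of the canonical
system `|K_{C'}| ⊂ S⁶C'` in `(ℤ/12)\C⁶`, transported to `B` by the Abel–Jacobi map, Lieberman's Lefschetz inverse and the projector
(Schoen pp. 12–13, 24–25); Abel–Jacobi and Brill–Noether images of `C`; restricted Picard / Fourier–Mukai sheaves. (ii) SHEAF /
perfect complex, Buchweitz–Flenner semiregular (BF Thm. 5.1; not yet a tree fact — filed directly as `LocalClauseAt`).
(iii) MARKMAN'S FRAME [Markman RM, Thm. 1.1.2 with `K = ℚ(√3)(i)`, `e = 4`, `d = 6`, `n = 6`]: a `B`-secant pair `F₁, F₂` on an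
RM abelian SIXFOLD `X` with `κ(Φ(F₁ ⊠ F₂^∨))` staying algebraic ("we postpone for future work the search for semiregular `B`-secant
sheaves for CM-fields with `[K:ℚ] > 2`", §1.1, last paragraph). OBSERVATION (this seat; elementary, to be checked by a refuter):
a Prym member whose cover is DIHEDRAL — `C` carries an involution `τ` with `τατ = α⁻¹` (exists over any `(C', τ̄, χ)` with
`τ̄^*χ = χ⁻¹`, `χ ∈ H¹(C', ℤ/12)` the class of the cover) — splits up to isogeny as `B ~ X × X`, `X := im(1 + τ_*) ⊂ B` an abelian
sixfold stable under `F = ℚ(s_B + s_B⁻¹) = ℚ(√3)` (`τ` commutes with `s_B + s_B⁻¹` and anticommutes with `i = s_B³`, which maps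
`X` onto `im(1 - τ_*)`): Markman's product shape `X × X̂` with a CURVE-DOMINATED RM factor, i.e. a candidate for DOOR #3's open slot
«a `K′`-secant object on a NON-induced RM 6-torus» (§5.4 (i)) at a point where, in addition, ALL `L`-Weil classes are already
algebraic (`prym_basepoint`).
WHY IT MIGHT FAIL: (a) VHC is open — no semiregular codimension-`3` object on any abelian `12`-fold of this family is known, and
Markman's own `[K:ℚ] = 4` sheaves are postponed in print; (b) RIGIDITY: a curve-built subvariety `Z ⊂ B` from which `(C, α)` can be
reconstructed deforms only over the `9`-dimensional Prym locus, so by Bloch's theorem read contrapositively it is NOT semiregular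
whenever `[Z]` stays Hodge on the `18`-dimensional family — semiregular candidates must forget the curve; (c) CLASS TEST: an object
deforming with the whole family has `ch` in the generic Hodge ring `𝒜^• = ⟨NS_F = ℚh ⊕ ℚ(√3·h), W_L⟩` [Markman RM, Prop. "generator
for the invariant subalgebra"]; at a Prym member the Hodge ring may be larger, and a candidate with a component outside `𝒜^•` is
dead — a finite linear-algebra check per candidate (CHEAPEST FALSIFIER, to run first on Schoen's `z_χ` and on `O_C`-type sheaves
on the dihedral factor `X`).

## References
[cite: Schoen1988HodgeWeil, Thm. 2.0 (p. 11), pp. 12–13 (the cycles z_χ), Cor. 3.1 (p. 24), pp. 25–26 (moduli count)]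
[cite: PatelZhang2025PrymHodge, Lemma 5.1, §5.1, Thm. 5.3] [cite: Markman2025SecantRealMultiplication, §1.1, Prop. 1.1.1, Thm. 1.1.2]
[cite: Markman2025SecantWeil, Thm. 1.5.1, §1.5] [cite: Bloch1972Semiregularity, Thm. (7.4), Remark (7.5)]
[cite: BuchweitzFlenner2003, Thm. 5.1, Thm. 5.2] [cite: Deligne1982HodgeCycles, §4 Cor. 4.2, Prop. 4.4, Lemma 4.6, proof of Thm. 4.8, §5]
[cite: CharlesSchnell2014Notes, Prop. 11.3.11] [cite: vanGeemen1994HodgeAV, 5.2, 5.4, 7.1] [cite: MoonenZarhin1998WeilClasses, §1]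
-/

noncomputable section

-- single-problem summit (Problem = Summit): the mandated namespace repeats `HodgeConjecture`.
set_option linter.dupNamespace false

open CategoryTheory CategoryTheory.Limits AlgebraicGeometry
open Literature.AlgebraicGeometry Literature.AlgebraicGeometry.Motives Literature.AlgebraicGeometry.HodgeTheory
open Literature.AlgebraicGeometry.Deligne1982
open Literature.AlgebraicTopology.SingularHomology
open Literature.AlgebraicGeometry.VanGeemen1994 (pullbackOne)
open Summit.HodgeConjecture.HodgeConjecture.WeilTypeLadder (mem_algebraicClasses_of_isOpen_subset_algebraicityLocus)
open Summit.HodgeConjecture.HodgeConjecture.Theorems.HyperbolicEightfoldsSqrtMinus7.AnchorObject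
  (cupPowTwo_mem_algebraicClasses_abelian)

namespace Summit.HodgeConjecture.HodgeConjecture.Cruxes.MarkmanBiquadraticTwelvefolds.PrymSeed


/-! ## §0 Vocabulary (verbatim from `Lines/birth.lean`: the route's polynomial and the crux body at fixed `(d, m)`) -/

/-- `R_(d,m)(S) = S² + 2d(1+m)·S + d²(m-1)²` — LITERALLY the route's polynomial (`E = L = ℚ[T]/(R_(d,m)(T²)) = ℚ(√-d, √m)`). -/
def bqPoly (d m : ℕ) : Polynomial ℤ :=
  Polynomial.X ^ 2 + Polynomial.C (2 * (d : ℤ) * (1 + (m : ℤ))) * Polynomial.X +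
    Polynomial.C ((d : ℤ) ^ 2 * ((m : ℤ) - 1) ^ 2)

/-- **X1 at fixed `(d, m)`** — the crux's body with `R_(d,m) = bqPoly d m` (the RUNG `X1At 1 3` is its `(1,3)` instance). -/
def X1At (d m : ℕ) : Prop :=
  ∀ (B : AbelianVariety ℂ) (η : B ⟶ B), IsHyperbolicWeilTypeCM B η (bqPoly d m) 2 3 →
    ∀ c ∈ weilClassesField B η ((bqPoly d m).comp (Polynomial.X ^ 2)) 6,
      IsRationalClass c → IsOfHodgeType B.dim B.X 6 3 3 c → c ∈ algebraicClasses B.X 3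

/-! ## §1 The local clause at a member, and its lci (Bloch) entrance -/

/-- **LOCAL CLAUSE at a member `P` for the class data `(h, w)`** (mechanism-agnostic; the shape of the tree's
`WeilAnchorLocalClause` without its unused abelian-fibre clause, in relative dimension `12`, codimension `3`): along every smooth
projective family `f : 𝒳 ⟶ S` of relative dimension `12` with quasi-projective total space over a smooth irreducible
quasi-projective base, for all global classes `H ∈ H²(𝒳)` (fibrewise rational `(1,1)`) and `W ∈ H⁶(𝒳)` (fibrewise rational
`(3,3)`) and every chart `e' : P ≅ 𝒳_{s₀}` with `e'^*H_{s₀} = h`, `e'^*W_{s₀} = w`, there are a Euclidean-open `U ∋ s₀` and `q ∈ ℚ`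
with `q·H_s³ + W_s` ALGEBRAIC on `𝒳_s` for all `s ∈ U`. Outputs of: Bloch's theorem for an lci semiregular seed
(`localClauseAt_of_blochSpread_of_blochSeed`), Buchweitz–Flenner Thm. 5.1 for a semiregular SHEAF with `ch₃ = q·h³ + w`
(Markman's secant sheaf), the pro-representability criterion BF Thm. 4.9. PREDICATE, nothing asserted.
[cite: Bloch1972Semiregularity, Thm. (7.4)] [cite: BuchweitzFlenner2003, Thm. 5.1 and Thm. 5.2] [cite: Markman2025SecantWeil, §1.5] -/
def LocalClauseAt (P : AbelianVariety ℂ) (h : complexBetti P.X 2) (w : complexBetti P.X (2 * 3)) : Prop :=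
  ∀ ⦃𝒳 S : SchemeOver ℂ⦄ (f : 𝒳 ⟶ S), IsSmoothProjectiveFamily f (2 * 3 * 2) →
    IsQuasiProjectiveOver 𝒳 → IsQuasiProjectiveOver S → IrreducibleSpace S.left → AlgebraicGeometry.Smooth S.hom →
    ∀ (H : complexBetti 𝒳 2) (W : complexBetti 𝒳 (2 * 3)),
      (∀ s : ComplexPoints S, IsRationalClass (complexBetti.map (fiberι f s) 2 H) ∧
          IsOfHodgeType (2 * 3 * 2) (fiberOver f s) 2 1 1 (complexBetti.map (fiberι f s) 2 H)) →
      (∀ s : ComplexPoints S, IsRationalClass (complexBetti.map (fiberι f s) (2 * 3) W) ∧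
          IsOfHodgeType (2 * 3 * 2) (fiberOver f s) (2 * 3) 3 3 (complexBetti.map (fiberι f s) (2 * 3) W)) →
      ∀ (s₀ : ComplexPoints S) (e' : P.X ≅ fiberOver f s₀),
        complexBetti.map e'.hom 2 (complexBetti.map (fiberι f s₀) 2 H) = h →
        complexBetti.map e'.hom (2 * 3) (complexBetti.map (fiberι f s₀) (2 * 3) W) = w →
        ∃ (U : Set (ComplexPoints S)) (q : ℚ), IsOpen U ∧ s₀ ∈ U ∧
          ∀ s ∈ U, ((q : ℚ) : ℂ) • cupPowTwo (complexBetti.map (fiberι f s) 2 H) 3 +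
            complexBetti.map (fiberι f s) (2 * 3) W ∈ algebraicClasses (fiberOver f s) 3

/-- **A Bloch seed for `q·h³ + w` on the twelvefold `P`** (the tree's `HasBlochSeedAt` with the ambient read as a `12`-fold and
codimension `3` — `HasBlochSeedAt n` hard-codes codimension `n` in a `2n`-fold): an INTEGRAL local complete intersection
`i : Z ↪ P` of codimension `3`, Bloch-semiregular (`IsBlochSemiregular i 12 3`), with `q·h³ + w` supported on `Z`. PREDICATE.
[cite: Bloch1972Semiregularity, Thm. (7.4) and Remark (7.5)] [cite: BuchweitzFlenner2003, Thm. 5.2 and (8.1)] -/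
def HasBlochSeedAt12 (P : AbelianVariety ℂ) (h : complexBetti P.X 2) (w : complexBetti P.X (2 * 3)) : Prop :=
  ∃ (Z : Scheme.{0}) (i : Z ⟶ P.X.left) (q : ℚ),
    IsClosedImmersion i ∧ IsRegularImmersionOfCodim i 3 ∧ AlgebraicGeometry.IsIntegral Z ∧
    (∀ z ∈ Set.range i.base, ((3 : ℕ) : ℕ∞) ≤ Order.coheight z) ∧
    IsBlochSemiregular i (2 * 3 * 2) 3 ∧
    ((q : ℚ) : ℂ) • cupPowTwo h 3 + w ∈ classesSupportedOn P.X (Set.range i.base) (2 * 3)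

/-- **BRIDGE (proved): Bloch's theorem (class level, REFEREED fact `BlochSemiregularSpread 12 3`) ∧ a Bloch seed ⟹ the local
clause.** Verbatim transposition of the tree's `weilAnchorLocalClause_of_blochSpread_of_blochSeedAt` to `(12, 3)`.
[cite: Bloch1972Semiregularity, Thm. (7.4)] [cite: BuchweitzFlenner2003, Thm. 5.2] [cite: VoisinTorino1994, Lecture 7, Thm. 2.4] -/
theorem localClauseAt_of_blochSpread_of_blochSeed (hB : BlochSemiregularSpread (2 * 3 * 2) 3)
    {P : AbelianVariety ℂ} {h : complexBetti P.X 2} {w : complexBetti P.X (2 * 3)} (hS : HasBlochSeedAt12 P h w) :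
    LocalClauseAt P h w := by
  obtain ⟨Z, i, q, hi, hreg, hint, hcoh, hsr, hsupp⟩ := hS
  intro 𝒳 S f hf h𝒳qp hSqp _ hsm H W hH hW s₀ e' hH₀ hW₀
  set B : complexBetti 𝒳 (2 * 3) := ((q : ℚ) : ℂ) • cupPowTwo H 3 + W with hBdef
  have hres : ∀ s : ComplexPoints S, complexBetti.map (fiberι f s) (2 * 3) B =
      ((q : ℚ) : ℂ) • cupPowTwo (complexBetti.map (fiberι f s) 2 H) 3 + complexBetti.map (fiberι f s) (2 * 3) W := by
    intro s
    rw [hBdef, map_add, map_smul, complexBetti_map_cupPowTwo']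
  have hBrat : ∀ s : ComplexPoints S,
      IsRationalClass (complexBetti.map (fiberι f s) (2 * 3) B) ∧
        IsOfHodgeType (2 * 3 * 2) (fiberOver f s) (2 * 3) 3 3 (complexBetti.map (fiberι f s) (2 * 3) B) := by
    intro s
    rw [hres]
    exact ⟨(((hH s).1.cupPowTwo 3).smul q).add (hW s).1,
      ((isOfHodgeType_cupPowTwo (hf.isSmoothProjective s) (hH s).2 3).smul _).add (hf.isSmoothProjective s) (hW s).2⟩
  have hx : complexBetti.map e'.hom (2 * 3) (complexBetti.map (fiberι f s₀) (2 * 3) B) =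
      ((q : ℚ) : ℂ) • cupPowTwo h 3 + w := by
    rw [hres, map_add, map_smul, complexBetti_map_cupPowTwo', hH₀, hW₀]
  obtain ⟨U, hUo, hs₀U, hU⟩ :=
    hB P.X Z i (((q : ℚ) : ℂ) • cupPowTwo h 3 + w) 𝒳 S f s₀ e' B hi hreg hint hcoh hsr hsupp hf h𝒳qp hSqp hsm hBrat hx
  refine ⟨U, q, hUo, hs₀U, fun s hs => ?_⟩
  rw [← hres]
  exact hU s hs

/-! ## §2 The two stubs' statements at fixed `(d, m)`: SEED (object-level anchor) and REACH (Deligne's family, up to isogeny) -/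

/-- **SEED at `(d, m)`** — a SEEDED POLARIZED HYPERBOLIC MEMBER of the split `(L,6)`-component: `(P, η_P)` of Weil type for
`L = ℚ[T]/(R_(d,m)(T²))` of `L`-rank `6` (`IsWeilTypeCM P η_P R 2 3`) with a class `h` which is a polarization class some real
multiple of which is KÄHLER (Deligne Thm. 4.8: a genuine polarization), whose Rosati involution is complex conjugation on `L`,
of SPLIT discriminant and with an `η_P^*`-stable rational Lagrangian (Cor. 4.2 (a)(b)) — the binders of the tree's
`IsPolarizedHyperbolicWeilTypeCM`, unbundled to name `h` —, a NON-ZERO RATIONAL `L`-Weil class `w ∈ W_L(P) ⊗ ℂ`, and the LOCAL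
CLAUSE for `(h, w)`. Candidate: Markman's `P = X ⊞ X̂` with the secant sheaf (his Thm. 1.1.2 is the `K`-case; the `L`-Weil
line inside `HW(X × X̂, η̂)` is the route's bet) or an lci Bloch seed via `localClauseAt_of_blochSpread_of_blochSeed`. OPEN. -/
def SeedAnchorAt (d m : ℕ) : Prop :=
  ∃ (P : AbelianVariety ℂ) (ηP : P ⟶ P) (hW : IsWeilTypeCM P ηP (bqPoly d m) 2 3) (h : complexBetti P.X 2)
    (w : complexBetti P.X (2 * 3)),
    IsPolarizationClass P.dim P.X h ∧
    (∃ s : ℝ, s ≠ 0 ∧ IsKaehlerClass P.dim P.X ((s : ℂ) • h)) ∧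
    (∀ x y : complexBetti P.X 1,
      polarizationPairingOne P.X h (P.dim - 1) (pullbackOne P ηP x) y =
        -polarizationPairingOne P.X h (P.dim - 1) x (pullbackOne P ηP y)) ∧
    (haveI : Fact (Irreducible (realPolyQ (bqPoly d m))) := hW.fact_irreducible_map_real
     HasWeilDiscriminantCM P ηP (bqPoly d m) 2 3 h (splitDiscriminantClassCM (bqPoly d m) 3)) ∧
    IsHyperbolicWeilType P ηP (3 * 2) h ∧
    w ∈ weilClassesField P ηP ((bqPoly d m).comp (Polynomial.X ^ 2)) (2 * 3) ∧ IsRationalClass w ∧ w ≠ 0 ∧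
    LocalClauseAt P h w

/-- **lci SEED at `(d, m)`**: the same member data with a BLOCH SEED (`HasBlochSeedAt12`) in place of the local clause. -/
def BlochSeedAt (d m : ℕ) : Prop :=
  ∃ (P : AbelianVariety ℂ) (ηP : P ⟶ P) (hW : IsWeilTypeCM P ηP (bqPoly d m) 2 3) (h : complexBetti P.X 2)
    (w : complexBetti P.X (2 * 3)),
    IsPolarizationClass P.dim P.X h ∧
    (∃ s : ℝ, s ≠ 0 ∧ IsKaehlerClass P.dim P.X ((s : ℂ) • h)) ∧
    (∀ x y : complexBetti P.X 1,
      polarizationPairingOne P.X h (P.dim - 1) (pullbackOne P ηP x) y =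
        -polarizationPairingOne P.X h (P.dim - 1) x (pullbackOne P ηP y)) ∧
    (haveI : Fact (Irreducible (realPolyQ (bqPoly d m))) := hW.fact_irreducible_map_real
     HasWeilDiscriminantCM P ηP (bqPoly d m) 2 3 h (splitDiscriminantClassCM (bqPoly d m) 3)) ∧
    IsHyperbolicWeilType P ηP (3 * 2) h ∧
    w ∈ weilClassesField P ηP ((bqPoly d m).comp (Polynomial.X ^ 2)) (2 * 3) ∧ IsRationalClass w ∧ w ≠ 0 ∧
    HasBlochSeedAt12 P h w

/-- An lci seed is a seed, granting Bloch's class-level theorem for `(12, 3)` (proved). [cite: Bloch1972Semiregularity, Thm. (7.4)] -/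
theorem seedAnchorAt_of_blochSpread_of_blochSeedAt {d m : ℕ} (hB : BlochSemiregularSpread (2 * 3 * 2) 3)
    (hS : BlochSeedAt d m) : SeedAnchorAt d m := by
  obtain ⟨P, ηP, hW, h, w, hpol, hkae, hros, hdisc, hlag, hwW, hwQ, hw0, hseed⟩ := hS
  exact ⟨P, ηP, hW, h, w, hpol, hkae, hros, hdisc, hlag, hwW, hwQ, hw0, localClauseAt_of_blochSpread_of_blochSeed hB hseed⟩

/-- **REACH at `(d, m)`** — DELIGNE'S FAMILY THROUGH THE SEEDED MEMBER, UP TO ISOGENY AT THE TARGET: for every seeded polarized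
hyperbolic member `(P, η_P, h, w)` as in `SeedAnchorAt` and every class-level hyperbolic target `(B, η)` of the same split
`(L,6)`-type (`IsHyperbolicWeilTypeCM B η R 2 3`, the crux's hypothesis), there are a smooth projective family `f : 𝒳 ⟶ S` of
relative dimension `12` (quasi-projective total space, smooth irreducible quasi-projective base: a neat level cover of the
connected Shimura variety `Γ\X⁺` of `(H₁(P,ℚ), L, φ_h)` with its universal abelian scheme), a chart `e' : P ≅ 𝒳_{s₀}`, an
abelian variety `B'` with `η'` and an `L`-EQUIVARIANT ISOGENY `g : B ⟶ B'` (`g ≫ η' = η ≫ g`; Landherr: same rank, split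
discriminant and signatures ⟹ `H₁(B,ℚ) ≅ H₁(P,ℚ)` as hermitian `L`-spaces; positivity for class-level targets: Deligne §5 /
`f ↦ f·φ`, `f⁶ ∈ N(L^×)`), a chart `e₁ : B' ≅ 𝒳_{s₁}`, and global classes `H ∈ H²(𝒳)` (the universal polarization: fibrewise
rational `(1,1)`, `e'^*H_{s₀} = h`) and `W ∈ H⁶(𝒳)` (fibrewise rational `(3,3)`: the flat extension of `w` — monodromy
`Γ ⊂ SU(V,φ)` acts on `⋀⁶_L V` by `det_L = 1`, every fibre is of Weil type so `⋀⁶_L H¹ ⊂ H^{3,3}` (Prop. 4.4), theorem of the fixed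
part —, `e'^*W_{s₀} = w`) such that `e₁^*W_{s₁}` is a NON-ZERO element of `W_L(B', η') ⊗ ℂ`. A TYPED MISSING INPUT MET IN PRINT
(size M–L typing on the carriers; the `K`-analogue is the tree's named fact `weilFamilyReach_hyperbolic`).
[cite: Deligne1982HodgeCycles, §4 Prop. 4.4, Lemma 4.6, proof of Thm. 4.8 (pp. 32–34), §5] [cite: Landherr1936HermitianForms]
[cite: vanGeemen1994HodgeAV, 5.4–5.5 and proof of Lemma 5.2] [cite: Milne2020HodgeClassesAV, §2 2.1] -/
def SeedReachAt (d m : ℕ) : Prop :=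
  ∀ (P : AbelianVariety ℂ) (ηP : P ⟶ P) (h : complexBetti P.X 2) (w : complexBetti P.X (2 * 3))
    [Fact (Irreducible (realPolyQ (bqPoly d m)))],
    IsWeilTypeCM P ηP (bqPoly d m) 2 3 → IsPolarizationClass P.dim P.X h →
    (∃ s : ℝ, s ≠ 0 ∧ IsKaehlerClass P.dim P.X ((s : ℂ) • h)) →
    (∀ x y : complexBetti P.X 1,
      polarizationPairingOne P.X h (P.dim - 1) (pullbackOne P ηP x) y =
        -polarizationPairingOne P.X h (P.dim - 1) x (pullbackOne P ηP y)) →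
    HasWeilDiscriminantCM P ηP (bqPoly d m) 2 3 h (splitDiscriminantClassCM (bqPoly d m) 3) →
    IsHyperbolicWeilType P ηP (3 * 2) h →
    w ∈ weilClassesField P ηP ((bqPoly d m).comp (Polynomial.X ^ 2)) (2 * 3) → IsRationalClass w → w ≠ 0 →
    ∀ (B : AbelianVariety ℂ) (η : B ⟶ B), IsHyperbolicWeilTypeCM B η (bqPoly d m) 2 3 →
      ∃ (𝒳 S : SchemeOver ℂ) (f : 𝒳 ⟶ S) (s₀ s₁ : ComplexPoints S) (e' : P.X ≅ fiberOver f s₀)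
        (B' : AbelianVariety ℂ) (η' : B' ⟶ B') (g : B ⟶ B') (e₁ : B'.X ≅ fiberOver f s₁)
        (H : complexBetti 𝒳 2) (W : complexBetti 𝒳 (2 * 3)),
        IsSmoothProjectiveFamily f (2 * 3 * 2) ∧ IsQuasiProjectiveOver 𝒳 ∧ IsQuasiProjectiveOver S ∧
        IrreducibleSpace S.left ∧ AlgebraicGeometry.Smooth S.hom ∧
        (∀ s : ComplexPoints S, IsRationalClass (complexBetti.map (fiberι f s) 2 H) ∧
            IsOfHodgeType (2 * 3 * 2) (fiberOver f s) 2 1 1 (complexBetti.map (fiberι f s) 2 H)) ∧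
        (∀ s : ComplexPoints S, IsRationalClass (complexBetti.map (fiberι f s) (2 * 3) W) ∧
            IsOfHodgeType (2 * 3 * 2) (fiberOver f s) (2 * 3) 3 3 (complexBetti.map (fiberι f s) (2 * 3) W)) ∧
        complexBetti.map e'.hom 2 (complexBetti.map (fiberι f s₀) 2 H) = h ∧
        complexBetti.map e'.hom (2 * 3) (complexBetti.map (fiberι f s₀) (2 * 3) W) = w ∧
        AbelianVariety.IsIsogeny g ∧ g ≫ η' = η ≫ g ∧ B'.dim = 2 * 3 * 2 ∧
        complexBetti.map e₁.hom (2 * 3) (complexBetti.map (fiberι f s₁) (2 * 3) W) ∈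
          weilClassesField B' η' ((bqPoly d m).comp (Polynomial.X ^ 2)) (2 * 3) ∧
        complexBetti.map e₁.hom (2 * 3) (complexBetti.map (fiberι f s₁) (2 * 3) W) ≠ 0

/-- SEED, all `(d, m)` (the registered stub's statement). -/
def SeedAnchors : Prop := ∀ d m : ℕ, 0 < d → 0 < m → ¬ IsSquare m → SeedAnchorAt d m

/-- lci SEED, all `(d, m)`. -/
def BlochSeeds : Prop := ∀ d m : ℕ, 0 < d → 0 < m → ¬ IsSquare m → BlochSeedAt d m

/-- REACH, all `(d, m)` (the registered stub's statement). -/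
def SeedReach : Prop := ∀ d m : ℕ, 0 < d → 0 < m → ¬ IsSquare m → SeedReachAt d m

/-- X1 for all `(d, m)` in the rung spelling (definitionally the crux; kept as a local name so that exactly ONE theorem of
this file concludes the crux decl by name). -/
def X1All : Prop := ∀ d m : ℕ, 0 < d → 0 < m → ¬ IsSquare m → X1At d m

/-! ## §3 Registered stubs -/

/-- **STUB SEED (rank: hardest; size L; OPEN).** A seeded polarized hyperbolic member of every split biquadratic
`(L,6)`-component. WHY IT MIGHT FAIL: Markman's semiregular secant sheaf is built for `K = ℚ(√-d)` only (twisted by a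
2-form); on `X ⊞ X̂` with real multiplication the `L`-Weil LINE `⋀⁶_L H¹` sits inside the 20-dimensional `K`-Weil space and no
semiregular object with `ch₃ ∈ ℚ h³ + W_L` is known; an lci Bloch seed in codimension `3` on an abelian 12-fold is equally
unknown (complete intersections of divisors give only `h³`-type classes). [cite: Markman2025SecantRealMultiplication, §11.2]
[cite: Markman2025SecantWeil, §1.5] [cite: Bloch1972Semiregularity, Remark (7.5)] -/
theorem stub_seedAnchor : SeedAnchors := by
  sorry

/-- **STUB REACH (size M–L typing; MET IN PRINT).** Deligne's family through the seeded member reaching every hyperbolic target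
up to `L`-isogeny, with flat `W`. WHY IT MIGHT FAIL (as typed): only through the carriers — `IsSmoothProjectiveFamily` /
`IsQuasiProjectiveOver` for the universal abelian scheme over a neat level cover, and the positivity supply for a class-level
hyperbolic target with large endomorphism algebra (an isogenous `B'` with a genuine split `L`-polarization must be chosen).
[cite: Deligne1982HodgeCycles, §4 proof of Thm. 4.8, Lemma 4.6, §5] [cite: Landherr1936HermitianForms] -/
theorem stub_seedReach : SeedReach := by
  sorry

/-- **RUNG (T3 PLAN-ONLY; same name and statement as `Birth.stub_rung_d1_m3`)**: X1 at `(d, m) = (1, 3)`, `L = ℚ(i, √3) = ℚ(ζ₁₂)`.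
PLAN on this line: `rung_d1_m3_of_seedAt` — prove `SeedAnchorAt 1 3` (one seeded member of the `ℚ(ζ₁₂)` split component) and
`SeedReachAt 1 3`. NOT PROVED. [cite: Markman2025SecantRealMultiplication, Thm. 1.1.2] -/
theorem stub_rung_d1_m3 : X1At 1 3 := by
  sorry

/-! ## §4 PROVED amplification: SEED ∧ REACH ⟹ X1 (at fixed `(d, m)`, for all `(d, m)`, the rung plan, the crux BY NAME) -/

/-- **AMPLIFICATION AT FIXED `(d, m)` (no sorry).** Local clause at the seeded fibre ⟹ a Euclidean-open set of algebraic fibres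
⟹ every fibre algebraic (algebraicity locus = countable union of closed algebraic subsets, one with interior) ⟹ `W_{s₁}` algebraic
(Lefschetz (1,1) and Kleiman for `q·H_{s₁}³` on the abelian fibre) ⟹ `g^*W_{s₁}` is a non-zero rational algebraic class of
`W_L(B) ⊗ ℂ` ⟹ all of `W_L(B) ⊗ ℂ` is algebraic (one-class lemma). [cite: CharlesSchnell2014Notes, Prop. 11.3.11]
[cite: Markman2025SurveySecant, §4] [cite: vanGeemen1994HodgeAV, 3.6–3.7] [cite: VoisinHodgeII2003, §9.2.4 Prop. 9.20] -/
theorem x1At_of_seed (d m : ℕ) (hA : SeedAnchorAt d m) (hR : SeedReachAt d m) : X1At d m := by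
  intro B η hH c hc hcQ _
  have hW : IsWeilTypeCM B η (bqPoly d m) 2 3 := hH.isWeilTypeCM
  obtain ⟨P, ηP, hWP, h, w, hpol, hkae, hros, hdisc, hlag, hwW, hwQ, hw0, hloc⟩ := hA
  haveI : Fact (Irreducible (realPolyQ (bqPoly d m))) := hWP.fact_irreducible_map_real
  obtain ⟨𝒳, S, f, s₀, s₁, e', B', η', g, e₁, H, W, hf, h𝒳, hS, hirr, hsm, hHfib, hWfib, hH₀, hW₀, hgi, hgc, hB'dim,
      hW₁mem, hW₁ne⟩ :=
    hR P ηP h w hWP hpol hkae hros hdisc hlag hwW hwQ hw0 B η hH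
  haveI := hirr
  -- (1) the local clause at the seeded fibre `s₀`
  obtain ⟨U, q, hUo, hs₀U, hUalg⟩ := hloc f hf h𝒳 hS hirr hsm H W hHfib hWfib s₀ e' hH₀ hW₀
  -- (2) the global class `q·H³ + W` is algebraic on an open set of fibres, hence on every fibre
  set Bq : complexBetti 𝒳 (2 * 3) := ((q : ℚ) : ℂ) • cupPowTwo H 3 + W with hBqdef
  have hres : ∀ s : ComplexPoints S, complexBetti.map (fiberι f s) (2 * 3) Bq =
      ((q : ℚ) : ℂ) • cupPowTwo (complexBetti.map (fiberι f s) 2 H) 3 + complexBetti.map (fiberι f s) (2 * 3) W := by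
    intro s
    rw [hBqdef, map_add, map_smul, complexBetti_map_cupPowTwo']
  have hUalg' : ∀ t ∈ U, complexBetti.map (fiberι f t) (2 * 3) Bq ∈ algebraicClasses (fiberOver f t) 3 := by
    intro t ht
    rw [hres]
    exact hUalg t ht
  have hall := mem_algebraicClasses_of_isOpen_subset_algebraicityLocus f h𝒳 hS hsm hf Bq hUo ⟨s₀, hs₀U⟩ hUalg'
  have halg₁ : ((q : ℚ) : ℂ) • cupPowTwo (complexBetti.map (fiberι f s₁) 2 H) 3 +
      complexBetti.map (fiberι f s₁) (2 * 3) W ∈ algebraicClasses (fiberOver f s₁) 3 := by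
    rw [← hres]
    exact hall s₁
  -- (3) `H_{s₁}³` is algebraic (Lefschetz (1,1) + Kleiman on the abelian variety `B' ≅ 𝒳_{s₁}`), hence so is `W_{s₁}`
  have hB'sp : IsSmoothProjective (2 * 3 * 2) B'.X := by
    have h' : IsSmoothProjective B'.dim B'.X := AbelianVariety.isSmoothProjective_holds (A := B')
    rwa [hB'dim] at h'
  have hh₁ : complexBetti.map e₁.hom 2 (complexBetti.map (fiberι f s₁) 2 H) ∈ algebraicClasses B'.X 1 :=
    lefschetzOneOne_rational_holds hB'sp _ ((isRationalClass_map_iff_of_iso e₁).2 (hHfib s₁).1)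
      ((isOfHodgeType_map_iff_of_iso e₁).2 (hHfib s₁).2)
  have hh₃ : complexBetti.map e₁.hom (2 * 3) (cupPowTwo (complexBetti.map (fiberι f s₁) 2 H) 3) ∈
      algebraicClasses B'.X 3 := by
    rw [complexBetti_map_cupPowTwo']
    exact cupPowTwo_mem_algebraicClasses_abelian B' hh₁ 2
  have hH₃ : cupPowTwo (complexBetti.map (fiberι f s₁) 2 H) 3 ∈ algebraicClasses (fiberOver f s₁) 3 :=
    (mem_algebraicClasses_map_iff_of_iso e₁).1 hh₃
  have hW₁ : complexBetti.map (fiberι f s₁) (2 * 3) W ∈ algebraicClasses (fiberOver f s₁) 3 := by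
    have h' := Submodule.sub_mem _ halg₁ (Submodule.smul_mem _ ((q : ℚ) : ℂ) hH₃)
    rwa [add_sub_cancel_left] at h'
  -- (4) transport `W_{s₁}` to `B'` (chart) and to `B` (the `L`-equivariant isogeny `g`)
  set w₁ : complexBetti B'.X (2 * 3) := complexBetti.map e₁.hom (2 * 3) (complexBetti.map (fiberι f s₁) (2 * 3) W)
    with hw₁def
  have hw₁alg : w₁ ∈ algebraicClasses B'.X 3 := (mem_algebraicClasses_map_iff_of_iso e₁).2 hW₁
  have hw₁Q : IsRationalClass w₁ := (isRationalClass_map_iff_of_iso e₁).2 (hWfib s₁).1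
  have hBsp : IsSmoothProjective B.dim B.X := AbelianVariety.isSmoothProjective_holds (A := B)
  have hgw : complexBetti.map g.hom.hom.hom (2 * 3) w₁ ∈ weilClassesField B η ((bqPoly d m).comp (Polynomial.X ^ 2)) (2 * 3) :=
    map_mem_weilClassesField_of_comm hgc hW₁mem
  have hgwQ : IsRationalClass (complexBetti.map g.hom.hom.hom (2 * 3) w₁) := hw₁Q.map _
  have hgwalg : complexBetti.map g.hom.hom.hom (2 * 3) w₁ ∈ algebraicClasses B.X 3 :=
    map_mem_algebraicClasses_of_abelianVariety hBsp B' g.hom.hom.hom hw₁alg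
  have hgw0 : complexBetti.map g.hom.hom.hom (2 * 3) w₁ ≠ 0 := fun h0 =>
    hW₁ne ((complexBetti_map_bijective_of_isIsogeny hgi (2 * 3)).1 (h0.trans (map_zero _).symm))
  -- (5) one non-zero rational algebraic Weil class suffices
  have hle := weilClassesField_le_algebraicClasses_of_isRationalClass_of_ne_zero hW.natDegree_comp hW.irreducible
    hW.eval₂_eq_zero hW.degree_mul_rank hW.k_pos hgw hgwQ hgw0 hgwalg
  exact hle hc

/-- lci variant: Bloch's class-level theorem for `(12, 3)` ∧ an lci seed ∧ REACH ⟹ X1 at `(d, m)` (proved). -/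
theorem x1At_of_blochSeed (d m : ℕ) (hB : BlochSemiregularSpread (2 * 3 * 2) 3) (hS : BlochSeedAt d m)
    (hR : SeedReachAt d m) : X1At d m :=
  x1At_of_seed d m (seedAnchorAt_of_blochSpread_of_blochSeedAt hB hS) hR

/-- **THE RUNG'S PLAN on this line (proved): `SeedAnchorAt 1 3 → SeedReachAt 1 3 → X1At 1 3`.** -/
theorem rung_d1_m3_of_seedAt (hA : SeedAnchorAt 1 3) (hR : SeedReachAt 1 3) : X1At 1 3 :=
  x1At_of_seed 1 3 hA hR

/-- SEED ∧ REACH for all `(d, m)` ⟹ X1 for all `(d, m)` (proved). -/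
theorem x1All_of_seed (hA : SeedAnchors) (hR : SeedReach) : X1All :=
  fun d m hd hm hsq => x1At_of_seed d m (hA d m hd hm hsq) (hR d m hd hm hsq)

/-- `X1All` IS the crux (definitional: `bqPoly d m` is the route's polynomial, `6 = 2·3`). -/
theorem x1All_iff : X1All ↔ Summit.HodgeConjecture.HodgeConjecture.Theses.BiquadraticSecantLift.MarkmanBiquadraticTwelvefolds :=
  ⟨fun h d m hd hm hsq B η hH c hc hcQ hcH => h d m hd hm hsq B η hH c hc hcQ hcH,
    fun h d m hd hm hsq B η hH c hc hcQ hcH => h d m hd hm hsq B η hH c hc hcQ hcH⟩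

/-- **COMPOSITION — concludes the crux BY NAME from the registered stubs** (sorries live only inside `stub_seedAnchor`,
`stub_seedReach`): `stub_seedAnchor → stub_seedReach → MarkmanBiquadraticTwelvefolds` via `x1All_of_seed`. -/
theorem MarkmanBiquadraticTwelvefolds_of_stubs :
    Summit.HodgeConjecture.HodgeConjecture.Theses.BiquadraticSecantLift.MarkmanBiquadraticTwelvefolds :=
  x1All_iff.1 (x1All_of_seed stub_seedAnchor stub_seedReach)


/-! ## §5 THE LEVER AT THE REFEREED ANCHOR (new in this file): a seeded member ON the genus-`4` `ℤ/12`-Prym locus -/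

/-- The BODY of `SeedAnchorAt d m` at a GIVEN member `(P, η_P)`: Weil type for `L = ℚ[T]/(R_(d,m)(T²))` of `L`-rank `6`, a
polarization class `h` some real multiple of which is Kähler, Rosati = complex conjugation on `L`, split discriminant, an
`η_P^*`-stable rational Lagrangian, a non-zero rational `L`-Weil class `w`, and the local clause for `(h, w)`.
[cite: Deligne1982HodgeCycles, §4 Cor. 4.2 and Thm. 4.8] [cite: Bloch1972Semiregularity, Thm. (7.4)] -/
def SeedBodyAt (d m : ℕ) (P : AbelianVariety ℂ) (ηP : P ⟶ P) : Prop :=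
  ∃ (hW : IsWeilTypeCM P ηP (bqPoly d m) 2 3) (h : complexBetti P.X 2) (w : complexBetti P.X (2 * 3)),
    IsPolarizationClass P.dim P.X h ∧
    (∃ s : ℝ, s ≠ 0 ∧ IsKaehlerClass P.dim P.X ((s : ℂ) • h)) ∧
    (∀ x y : complexBetti P.X 1,
      polarizationPairingOne P.X h (P.dim - 1) (pullbackOne P ηP x) y =
        -polarizationPairingOne P.X h (P.dim - 1) x (pullbackOne P ηP y)) ∧
    (haveI : Fact (Irreducible (realPolyQ (bqPoly d m))) := hW.fact_irreducible_map_real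
     HasWeilDiscriminantCM P ηP (bqPoly d m) 2 3 h (splitDiscriminantClassCM (bqPoly d m) 3)) ∧
    IsHyperbolicWeilType P ηP (3 * 2) h ∧
    w ∈ weilClassesField P ηP ((bqPoly d m).comp (Polynomial.X ^ 2)) (2 * 3) ∧ IsRationalClass w ∧ w ≠ 0 ∧
    LocalClauseAt P h w

/-- The BODY of `BlochSeedAt d m` at a given member: the same data with a Bloch seed (`HasBlochSeedAt12`) for `(h, w)`.
[cite: Bloch1972Semiregularity, Thm. (7.4) and Remark (7.5)] [cite: BuchweitzFlenner2003, Thm. 5.2] -/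
def BlochBodyAt (d m : ℕ) (P : AbelianVariety ℂ) (ηP : P ⟶ P) : Prop :=
  ∃ (hW : IsWeilTypeCM P ηP (bqPoly d m) 2 3) (h : complexBetti P.X 2) (w : complexBetti P.X (2 * 3)),
    IsPolarizationClass P.dim P.X h ∧
    (∃ s : ℝ, s ≠ 0 ∧ IsKaehlerClass P.dim P.X ((s : ℂ) • h)) ∧
    (∀ x y : complexBetti P.X 1,
      polarizationPairingOne P.X h (P.dim - 1) (pullbackOne P ηP x) y =
        -polarizationPairingOne P.X h (P.dim - 1) x (pullbackOne P ηP y)) ∧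
    (haveI : Fact (Irreducible (realPolyQ (bqPoly d m))) := hW.fact_irreducible_map_real
     HasWeilDiscriminantCM P ηP (bqPoly d m) 2 3 h (splitDiscriminantClassCM (bqPoly d m) 3)) ∧
    IsHyperbolicWeilType P ηP (3 * 2) h ∧
    w ∈ weilClassesField P ηP ((bqPoly d m).comp (Polynomial.X ^ 2)) (2 * 3) ∧ IsRationalClass w ∧ w ≠ 0 ∧
    HasBlochSeedAt12 P h w

/-- `SeedAnchorAt d m` is «some member carries a seed body» (definitional). -/
theorem seedAnchorAt_iff_exists_body (d m : ℕ) :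
    SeedAnchorAt d m ↔ ∃ (P : AbelianVariety ℂ) (ηP : P ⟶ P), SeedBodyAt d m P ηP :=
  Iff.rfl

/-- `BlochSeedAt d m` is «some member carries a Bloch body» (definitional). -/
theorem blochSeedAt_iff_exists_body (d m : ℕ) :
    BlochSeedAt d m ↔ ∃ (P : AbelianVariety ℂ) (ηP : P ⟶ P), BlochBodyAt d m P ηP :=
  Iff.rfl

/-- A Bloch body is a seed body, granting the refereed class-level Bloch theorem for `(12, 3)` (proved, via §1's bridge).
[cite: Bloch1972Semiregularity, Thm. (7.4)] [cite: BuchweitzFlenner2003, Thm. 5.2] -/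
theorem seedBodyAt_of_blochSpread_of_blochBodyAt (hB : BlochSemiregularSpread (2 * 3 * 2) 3) {d m : ℕ}
    {P : AbelianVariety ℂ} {ηP : P ⟶ P} (hS : BlochBodyAt d m P ηP) : SeedBodyAt d m P ηP := by
  obtain ⟨hW, h, w, hpol, hkae, hros, hdisc, hlag, hwW, hwQ, hw0, hseed⟩ := hS
  exact ⟨hW, h, w, hpol, hkae, hros, hdisc, hlag, hwW, hwQ, hw0, localClauseAt_of_blochSpread_of_blochSeed hB hseed⟩

/-- `R_(1,3)(S) = S² + 8S + 4` — the cell `(d, m) = (1, 3)`, `L = ℚ(i, √3) = ℚ(ζ₁₂)`; literally the polynomial of the two Prym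
facts of `WeilClassesCyclicPrymDegreeTwelve`. [cite: PatelZhang2025PrymHodge, §5.1] -/
theorem bqPoly_one_three :
    bqPoly 1 3 = Polynomial.X ^ 2 + Polynomial.C (8 : ℤ) * Polynomial.X + Polynomial.C (4 : ℤ) := by
  unfold bqPoly
  norm_num

/-- **The genus-`4` `ℤ/12`-Prym binder block** (the hypotheses of `Schoen1988_cyclicPrym_weilClasses_algebraic_degreeTwelve_allGenera`
and `cyclicPrymTwelve_isHyperbolicWeilTypeCM_allGenera` at `n = 3`): `C` a smooth projective curve with Jacobian `𝒥` of dimension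
`37 = 12·3 + 1`, `α` an automorphism with `α¹² = 𝟙` whose powers `α⁴`, `α⁶` have no fixed complex point (a FREE `ℤ/12`-action, so
`C → C' = C/(ℤ/12)` is étale onto a genus-`4` curve), `s = α_*`, `Φ = Φ₁₂(s) = 𝟙 - s² + s⁴` (so `(ker Φ)⁰ = B_prim`, a twelvefold),
`s_B` the restriction of `s` to `B`, and the Weil generator `η = -𝟙 + 2s_B² + s_B³` (`η⁴ + 8η² + 4 = 0`). PREDICATE.
[cite: Schoen1988HodgeWeil, Thm. 2.0 and Cor. 3.1 at (q, m, r) = (4, 12, 0)] [cite: PatelZhang2025PrymHodge, Lemma 5.1 and Def. 5.2] -/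
def IsPrymTwelvefold (C : SchemeOver ℂ) (𝒥 : Jacobian C) (α : C ⟶ C) (s Φ : 𝒥.J ⟶ 𝒥.J)
    (sB η : AbelianVariety.kerComponent Φ ⟶ AbelianVariety.kerComponent Φ) : Prop :=
  IsSmoothProjective 1 C ∧ 𝒥.J.dim = 37 ∧
    α ≫ α ≫ α ≫ α ≫ α ≫ α ≫ α ≫ α ≫ α ≫ α ≫ α ≫ α = 𝟙 C ∧
    (∀ P : ComplexPoints C, P ≫ (α ≫ α ≫ α ≫ α) ≠ P ∧ P ≫ (α ≫ α ≫ α ≫ α ≫ α ≫ α) ≠ P) ∧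
    s = 𝒥.pushforward 𝒥 α ∧ Φ = 𝟙 𝒥.J - s ≫ s + s ≫ s ≫ s ≫ s ∧
    sB ≫ AbelianVariety.kerComponentι Φ = AbelianVariety.kerComponentι Φ ≫ s ∧
    η = -𝟙 _ + 2 • (sB ≫ sB) + sB ≫ sB ≫ sB

/-- **`PrymSeed13` — THE LEVER AT THE ANCHOR (T3 designate; OPEN).** Some genus-`4` `ℤ/12`-Prym twelvefold
`(B, η) = ((ker Φ₁₂(α_*))⁰, -𝟙 + 2s_B² + s_B³)` carries a SEED BODY for the cell `(1, 3)`: a polarization class `h` (Kähler multiple,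
Rosati = complex conjugation on `ℚ(ζ₁₂)`, split discriminant, `η^*`-stable rational Lagrangian), a non-zero rational `ℚ(ζ₁₂)`-Weil
class `w ∈ U_prim ⊗ ℂ ⊂ H⁶(B)`, and the LOCAL CLAUSE `LocalClauseAt B h w`. It is `SeedAnchorAt 1 3` LOCALISED to the `9`-dimensional
anchor locus, where the clause's base-point requirement holds for all candidate data (`prym_basepoint`) and explicit curve-built
cycles and sheaves exist to be tested for semiregularity. [cite: Schoen1988HodgeWeil, Cor. 3.1 and pp. 25–26]
[cite: Markman2025SecantRealMultiplication, Thm. 1.1.2] [cite: Bloch1972Semiregularity, Thm. (7.4)] -/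
def PrymSeed13 : Prop :=
  ∃ (C : SchemeOver ℂ) (𝒥 : Jacobian C) (α : C ⟶ C) (s Φ : 𝒥.J ⟶ 𝒥.J)
    (sB η : AbelianVariety.kerComponent Φ ⟶ AbelianVariety.kerComponent Φ),
    IsPrymTwelvefold C 𝒥 α s Φ sB η ∧ SeedBodyAt 1 3 (AbelianVariety.kerComponent Φ) η

/-- **`PrymBlochSeed13` — the lci entrance at the anchor**: some genus-`4` `ℤ/12`-Prym twelvefold carries a BLOCH BODY for the cell
`(1, 3)` (an integral, Bloch-semiregular lci `Z ⊂ B` of codimension `3` supporting `q·h³ + w`). PREDICATE (not a stub: it implies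
`PrymSeed13` by `prymSeed13_of_blochSpread`). [cite: Bloch1972Semiregularity, Thm. (7.4) and Remark (7.5)] -/
def PrymBlochSeed13 : Prop :=
  ∃ (C : SchemeOver ℂ) (𝒥 : Jacobian C) (α : C ⟶ C) (s Φ : 𝒥.J ⟶ 𝒥.J)
    (sB η : AbelianVariety.kerComponent Φ ⟶ AbelianVariety.kerComponent Φ),
    IsPrymTwelvefold C 𝒥 α s Φ sB η ∧ BlochBodyAt 1 3 (AbelianVariety.kerComponent Φ) η

/-- **STUB — THE LEVER AT THE ANCHOR (T3 designate `stub_prymSeed13`; PLAN-ONLY; size L; OPEN).** A seeded member ON the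
`ℤ/12`-Prym locus of the `(1,3)` cell. NAMED TECHNIQUES: (i) Bloch's theorem for an lci semiregular curve-built cycle on `B ⊂ J(C)`
with class `q·h³ + w` (`prymSeed13_of_blochSpread`); (ii) a Buchweitz–Flenner semiregular sheaf / perfect complex with `ch₃ ∈ ℚh³ + w`
(+ divisor terms); (iii) Markman's `B`-secant pair (his Thm. 1.1.2 at `K = ℚ(√3)(i)`, `d = 6`) on the RM sixfold factor `X` of a
DIHEDRAL Prym member `B ~ X × X̂`, with `κ(Φ(F₁ ⊠ F₂^∨))` algebraic near the point. WHY IT MIGHT FAIL: the variational Hodge conjecture is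
open and no semiregular codimension-`3` object on an abelian `12`-fold of this family is known (Markman postpones the `[K:ℚ] = 4`
sheaves in print); curve-remembering cycles deform only over the `9`-dimensional Prym locus and are therefore NOT semiregular when
their class stays Hodge on the `18`-dimensional family (Bloch, contrapositive); every candidate must first pass the class test
`ch ∈ ⟨ℚh ⊕ ℚ√3·h, W_L⟩`. NOT PROVED. [cite: Markman2025SecantRealMultiplication, §1.1 (last paragraph) and Thm. 1.1.2]
[cite: Bloch1972Semiregularity, Thm. (7.4), Remark (7.5)] [cite: BuchweitzFlenner2003, Thm. 5.1] [cite: Schoen1988HodgeWeil, pp. 12–13, 24–26] -/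
theorem stub_prymSeed13 : PrymSeed13 := by
  sorry

/-- **A Prym seed is a seed of the cell `(1, 3)`** (proved: forget where the member came from). -/
theorem seedAnchorAt13_of_prymSeed (hA : PrymSeed13) : SeedAnchorAt 1 3 := by
  obtain ⟨C, 𝒥, α, s, Φ, sB, η, -, hbody⟩ := hA
  exact ⟨AbelianVariety.kerComponent Φ, η, hbody⟩

/-- **The lci entrance at the anchor** (proved): Bloch's class-level theorem for `(12, 3)` ∧ a Prym Bloch body ⟹ a Prym seed.
[cite: Bloch1972Semiregularity, Thm. (7.4)] -/
theorem prymSeed13_of_blochSpread (hB : BlochSemiregularSpread (2 * 3 * 2) 3) (hS : PrymBlochSeed13) : PrymSeed13 := by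
  obtain ⟨C, 𝒥, α, s, Φ, sB, η, hd, hbody⟩ := hS
  exact ⟨C, 𝒥, α, s, Φ, sB, η, hd, seedBodyAt_of_blochSpread_of_blochBodyAt hB hbody⟩

/-- **THE RUNG'S PLAN ON THIS LINE (proved): LEVER AT THE ANCHOR ∧ REACH ⟹ the whole `(1, 3)` cell `X1At 1 3`**
("output = the whole 18-dimensional component", by §4's amplification `x1At_of_seed`).
[cite: Deligne1982HodgeCycles, §4 proof of Thm. 4.8] [cite: CharlesSchnell2014Notes, Prop. 11.3.11] -/
theorem rung_d1_m3_of_prymSeed (hA : PrymSeed13) (hR : SeedReachAt 1 3) : X1At 1 3 :=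
  x1At_of_seed 1 3 (seedAnchorAt13_of_prymSeed hA) hR

/-- lci variant of the rung's plan (proved). [cite: Bloch1972Semiregularity, Thm. (7.4)] -/
theorem rung_d1_m3_of_prymBlochSeed (hB : BlochSemiregularSpread (2 * 3 * 2) 3) (hS : PrymBlochSeed13)
    (hR : SeedReachAt 1 3) : X1At 1 3 :=
  rung_d1_m3_of_prymSeed (prymSeed13_of_blochSpread hB hS) hR

/-- **MEMBERSHIP (granted the DERIVED placement statement): every genus-`4` `ℤ/12`-Prym twelvefold is a member of the cell `(1, 3)`**
— `IsHyperbolicWeilTypeCM B η (bqPoly 1 3) 2 3` (in particular `IsWeilTypeCM B η (bqPoly 1 3) 2 3`, the first conjunct of the seed body,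
and the `Fact` that `ℚ[S]/(R_(1,3)) = ℚ(√3)` is a field). [cite: PatelZhang2025PrymHodge, Lemma 5.1 and §5.1] [cite: Deligne1982HodgeCycles, §4 Cor. 4.2] -/
theorem prym_mem_cell (hP : cyclicPrymTwelve_isHyperbolicWeilTypeCM_allGenera) {C : SchemeOver ℂ} {𝒥 : Jacobian C}
    {α : C ⟶ C} {s Φ : 𝒥.J ⟶ 𝒥.J} {sB η : AbelianVariety.kerComponent Φ ⟶ AbelianVariety.kerComponent Φ}
    (hd : IsPrymTwelvefold C 𝒥 α s Φ sB η) :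
    IsHyperbolicWeilTypeCM (AbelianVariety.kerComponent Φ) η (bqPoly 1 3) 2 3 := by
  obtain ⟨hC, hdim, hα, hfree, hs, hΦ, hsB, hη⟩ := hd
  rw [bqPoly_one_three]
  exact hP 3 (by norm_num) C 𝒥 α hC (hdim.trans (by norm_num)) hα hfree s Φ hs hΦ sB η hsB hη

/-- **BASE-POINT TEST AT THE ANCHOR (proved; consumes Schoen's REFEREED fact).** At a genus-`4` `ℤ/12`-Prym twelvefold, for EVERY
polarization class `h`, EVERY class `w` of the `ℚ(ζ₁₂)`-Weil space and EVERY `q ∈ ℚ`, the class `q·h³ + w` is algebraic (`h³` by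
`IsPolarizationClass.mem_algebraicClasses` and the abelian-variety cup-product closure; `w` by Schoen Cor. 3.1). This is the
requirement `s₀ ∈ U` of `LocalClauseAt B h w` — open at a general member of the cell, discharged at the anchor for all candidates.
[cite: Schoen1988HodgeWeil, Cor. 3.1 (p. 24)] [cite: PatelZhang2025PrymHodge, Thm. 5.3] [cite: VoisinHodgeII2003, proof of Lemma 9.18] -/
theorem prym_basepoint (hS : Schoen1988_cyclicPrym_weilClasses_algebraic_degreeTwelve_allGenera) {C : SchemeOver ℂ}
    {𝒥 : Jacobian C} {α : C ⟶ C} {s Φ : 𝒥.J ⟶ 𝒥.J}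
    {sB η : AbelianVariety.kerComponent Φ ⟶ AbelianVariety.kerComponent Φ} (hd : IsPrymTwelvefold C 𝒥 α s Φ sB η)
    {h : complexBetti (AbelianVariety.kerComponent Φ).X 2}
    (hpol : IsPolarizationClass (AbelianVariety.kerComponent Φ).dim (AbelianVariety.kerComponent Φ).X h)
    {w : complexBetti (AbelianVariety.kerComponent Φ).X (2 * 3)}
    (hw : w ∈ weilClassesField (AbelianVariety.kerComponent Φ) η ((bqPoly 1 3).comp (Polynomial.X ^ 2)) (2 * 3)) (q : ℚ) :
    ((q : ℚ) : ℂ) • cupPowTwo h 3 + w ∈ algebraicClasses (AbelianVariety.kerComponent Φ).X 3 := by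
  obtain ⟨hC, hdim, hα, hfree, hs, hΦ, hsB, hη⟩ := hd
  rw [bqPoly_one_three] at hw
  have hwalg : w ∈ algebraicClasses (AbelianVariety.kerComponent Φ).X 3 :=
    hS 3 (by norm_num) C 𝒥 α hC (hdim.trans (by norm_num)) hα hfree s Φ hs hΦ sB η hsB hη w hw
  have hh₃ : cupPowTwo h 3 ∈ algebraicClasses (AbelianVariety.kerComponent Φ).X 3 :=
    cupPowTwo_mem_algebraicClasses_abelian (AbelianVariety.kerComponent Φ) hpol.mem_algebraicClasses 2
  exact Submodule.add_mem _ (Submodule.smul_mem _ _ hh₃) hwalg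

/-- **REDUCTION TO LOCAL DATA AT ONE PRYM MEMBER (proved; consumes the placement statement).** `PrymSeed13` follows from: one
genus-`4` `ℤ/12`-Prym twelvefold `(B, η)`, a class `h` with the five polarization properties, a non-zero rational `ℚ(ζ₁₂)`-Weil
class `w`, and `LocalClauseAt B h w` — Weil-type-ness for `R_(1,3)` being supplied by `prym_mem_cell`. (The `Fact` binder is
available as `(prym_mem_cell hP hd).isWeilTypeCM.fact_irreducible_map_real`.) [cite: Deligne1982HodgeCycles, §4 Cor. 4.2 and Thm. 4.8] -/
theorem prymSeed13_of_localData (hP : cyclicPrymTwelve_isHyperbolicWeilTypeCM_allGenera) {C : SchemeOver ℂ}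
    {𝒥 : Jacobian C} {α : C ⟶ C} {s Φ : 𝒥.J ⟶ 𝒥.J}
    {sB η : AbelianVariety.kerComponent Φ ⟶ AbelianVariety.kerComponent Φ} (hd : IsPrymTwelvefold C 𝒥 α s Φ sB η)
    [Fact (Irreducible (realPolyQ (bqPoly 1 3)))]
    (h : complexBetti (AbelianVariety.kerComponent Φ).X 2) (w : complexBetti (AbelianVariety.kerComponent Φ).X (2 * 3))
    (hpol : IsPolarizationClass (AbelianVariety.kerComponent Φ).dim (AbelianVariety.kerComponent Φ).X h)
    (hkae : ∃ s : ℝ, s ≠ 0 ∧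
      IsKaehlerClass (AbelianVariety.kerComponent Φ).dim (AbelianVariety.kerComponent Φ).X ((s : ℂ) • h))
    (hros : ∀ x y : complexBetti (AbelianVariety.kerComponent Φ).X 1,
      polarizationPairingOne (AbelianVariety.kerComponent Φ).X h ((AbelianVariety.kerComponent Φ).dim - 1)
          (pullbackOne (AbelianVariety.kerComponent Φ) η x) y =
        -polarizationPairingOne (AbelianVariety.kerComponent Φ).X h ((AbelianVariety.kerComponent Φ).dim - 1) x
          (pullbackOne (AbelianVariety.kerComponent Φ) η y))
    (hdisc : HasWeilDiscriminantCM (AbelianVariety.kerComponent Φ) η (bqPoly 1 3) 2 3 h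
      (splitDiscriminantClassCM (bqPoly 1 3) 3))
    (hlag : IsHyperbolicWeilType (AbelianVariety.kerComponent Φ) η (3 * 2) h)
    (hwW : w ∈ weilClassesField (AbelianVariety.kerComponent Φ) η ((bqPoly 1 3).comp (Polynomial.X ^ 2)) (2 * 3))
    (hwQ : IsRationalClass w) (hw0 : w ≠ 0) (hloc : LocalClauseAt (AbelianVariety.kerComponent Φ) h w) :
    PrymSeed13 :=
  ⟨C, 𝒥, α, s, Φ, sB, η, hd, (prym_mem_cell hP hd).isWeilTypeCM, h, w, hpol, hkae, hros, hdisc, hlag, hwW, hwQ, hw0, hloc⟩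

/-- lci variant of the reduction (proved): a Bloch seed at one Prym member gives `PrymBlochSeed13`. [cite: Bloch1972Semiregularity, Thm. (7.4)] -/
theorem prymBlochSeed13_of_localData (hP : cyclicPrymTwelve_isHyperbolicWeilTypeCM_allGenera) {C : SchemeOver ℂ}
    {𝒥 : Jacobian C} {α : C ⟶ C} {s Φ : 𝒥.J ⟶ 𝒥.J}
    {sB η : AbelianVariety.kerComponent Φ ⟶ AbelianVariety.kerComponent Φ} (hd : IsPrymTwelvefold C 𝒥 α s Φ sB η)
    [Fact (Irreducible (realPolyQ (bqPoly 1 3)))]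
    (h : complexBetti (AbelianVariety.kerComponent Φ).X 2) (w : complexBetti (AbelianVariety.kerComponent Φ).X (2 * 3))
    (hpol : IsPolarizationClass (AbelianVariety.kerComponent Φ).dim (AbelianVariety.kerComponent Φ).X h)
    (hkae : ∃ s : ℝ, s ≠ 0 ∧
      IsKaehlerClass (AbelianVariety.kerComponent Φ).dim (AbelianVariety.kerComponent Φ).X ((s : ℂ) • h))
    (hros : ∀ x y : complexBetti (AbelianVariety.kerComponent Φ).X 1,
      polarizationPairingOne (AbelianVariety.kerComponent Φ).X h ((AbelianVariety.kerComponent Φ).dim - 1)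
          (pullbackOne (AbelianVariety.kerComponent Φ) η x) y =
        -polarizationPairingOne (AbelianVariety.kerComponent Φ).X h ((AbelianVariety.kerComponent Φ).dim - 1) x
          (pullbackOne (AbelianVariety.kerComponent Φ) η y))
    (hdisc : HasWeilDiscriminantCM (AbelianVariety.kerComponent Φ) η (bqPoly 1 3) 2 3 h
      (splitDiscriminantClassCM (bqPoly 1 3) 3))
    (hlag : IsHyperbolicWeilType (AbelianVariety.kerComponent Φ) η (3 * 2) h)
    (hwW : w ∈ weilClassesField (AbelianVariety.kerComponent Φ) η ((bqPoly 1 3).comp (Polynomial.X ^ 2)) (2 * 3))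
    (hwQ : IsRationalClass w) (hw0 : w ≠ 0) (hseed : HasBlochSeedAt12 (AbelianVariety.kerComponent Φ) h w) :
    PrymBlochSeed13 :=
  ⟨C, 𝒥, α, s, Φ, sB, η, hd, (prym_mem_cell hP hd).isWeilTypeCM, h, w, hpol, hkae, hros, hdisc, hlag, hwW, hwQ, hw0, hseed⟩

end Summit.HodgeConjecture.HodgeConjecture.Cruxes.MarkmanBiquadraticTwelvefolds.PrymSeed

end
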